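import Summits.QuantumFields.YangMills.Theorems.SwapVirialDeficitSectorLaplaceTrMainTerm
import Summits.QuantumFields.YangMills.Theorems.SwapVirialDeficitSectorLaplaceBTubeStiffness
import Summits.QuantumFields.YangMills.Theorems.SwapVirialDeficitSectorStiffnessTrChart
import HarnessLib

/-!
# STUB (S-001-good) OF SKELETON ➎: ★★★ THE 001 STIFFNESS IN THE LETTERS `(δ, η)` FROM THE √b LAW, MODULO THRESHOLD ARITHMETIC
# (free-hands support of ⟨stmt-QuantumFields-24197⟩ `SwapVirialDeficit.SwapGluedStiffness`; cell ym-idea-1; twin of w2 g59's ✓`bTube_stiff_of_farFloor` for sector 001 on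
# the WHOLE space — no region, no far-floor hypothesis; assembler fcl-p3 g48)

★★★ `tr_stiff (ε) (hz) (hF) (hR) (hR1) (hsmall) (hDR) (hb1) (hrate) (habs)`: for good sign patterns, a radius `0 < R ≤ 1` with `1136016L⁴R ≤ λ₁∕(8(m+8))`, `2R² ≤ 1`
(`λ₁ = (5408(1+|Fol L|)L⁶)⁻¹`, `m = dim V_B = 18L⁴ − 1`), and `b ≥ 1` with `K₃∕√b + K₄∕b + b^{−1∕4} ≤ 1∕(20000L⁴)` and the tail absorption
`e^{−t·R²∕(10816(1+|Fol L|)L⁶)}·U₀ ≤ t^{−1∕4}(2π∕t)^{m∕2}M₀` for `t ∈ [b, 2b]` (`U₀ = π·e^{|log(coneConst³∕64)| + 18L⁴}`, `M₀ = (1∕4)∕√((39984L⁴)^{m})`):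
`stiffKappa L (1∕8) · ∫ e^{−bF₁} dμ_B ≤ b · ∫ F₁ e^{−bF₁} dμ_B`, `F₁(δ,η) = trGnoDeficit uJ z₁ (sectorChar z₁) (hubAt δ 1) ε η`.
Route (w2's): ✓`tr_mainTerm_package` (law + determinant window + integrable main density) ⟹ main-term floor `M ≥ M₀` on the unit square ⟹ relative two-sided log laws at
`b` and `(1+h)b`, `h = 1∕(40L⁴)` (✓`twoSided_logLaw_of_relative`) ⟹ ✓`stiffness_of_twoSided_logLaplace_finite` with `e = m∕2 ≥ α` and ✓`stiff_budget`.

HONEST LABEL: the 001 stiffness modulo threshold arithmetic, in the letters; the reading on `chartMeasure L`, the thresholds and `stub_h001_good` remain OPEN, as do (S-core-tip),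
(S-end-G), ⟨24197⟩ ∕ ⟨24194⟩; item of record ⟨24085⟩ SubOctaveBounded aside ∕ untouched; the Yang–Mills mass gap is NOT proved; no summit is proved by a line.  THEOREMS ONLY
(0 `def`, 0 `sorry`), standard axioms, no instances.  Seat ym-line-fcl-p3 g48 (cell ym-idea-1, free hands), `--supports stmt-QuantumFields-24197`.
References: [cite: Luscher1983, §2]; [cite: Griffiths1964]; [cite: HasenpflugRudolfSprungk2024, App. 4.1 Thm 16]; [folklore].
-/

set_option autoImplicit false
set_option synthInstance.maxSize 1024

noncomputable section

open MeasureTheory Quaternion Set Metric Module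
open scoped Quaternion BigOperators ENNReal InnerProductSpace
open Literature.MathematicalPhysics.QuantumLattice
open Literature.MathematicalPhysics.QuantumFieldTheory hiding SU2
open Summit.QuantumFields.YangMills.Theorems.SwapTwistDeficit.ToronLog

namespace Summit.QuantumFields.YangMills.Theorems.SwapVirialDeficit.BlowUpRing

open Summit.QuantumFields.YangMills.Theorems.FemtoTransferGap
open Summit.QuantumFields.YangMills.Theorems.FemtoTransferGap.TT
open Summit.QuantumFields.YangMills.Theorems.VirialFluxGap.RingDeficit
open Summit.QuantumFields.YangMills.Theorems.SwapVirialDeficit.SwapRing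
open Summit.QuantumFields.YangMills.Theorems.SwapVirialDeficit.SectorLaplace


variable {L : ℕ} [NeZero L]

set_option maxHeartbeats 800000 in
/-- ★★★ **THE 001 STIFFNESS FROM THE √b LAW, IN THE LETTERS `(δ, η)`, MODULO THRESHOLD ARITHMETIC** (good sign patterns; `λ₁ = (5408(1+|Fol L|)L⁶)⁻¹`, `m = dim V_B`,
`M₀ = (1∕4)∕√((39984L⁴)^{m})`, `U₀ = π·e^{|log(coneConst³∕64)| + 18L⁴}`): for `0 < R ≤ 1` with `1136016L⁴R ≤ λ₁∕(8(m+8))`, `2R² ≤ 1`, and `b ≥ 1` with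
`K₃∕√b + K₄∕b + b^{−1∕4} ≤ 1∕(20000L⁴)` and `e^{−t·R²∕(10816(1+|Fol L|)L⁶)}U₀ ≤ t^{−1∕4}(2π∕t)^{m∕2}M₀` for `t ∈ [b, 2b]`:
`stiffKappa L (1∕8) · ∫ e^{−bF₁} dμ_B ≤ b · ∫ F₁ e^{−bF₁} dμ_B`. [cite: Luscher1983, §2] [cite: Griffiths1964] -/
theorem tr_stiff (ε : GnoSign L) (hz : ε.2.1 = true) (hF : ε.2.2 = fun _ => true) {R b : ℝ} (hR : 0 < R) (hR1 : R ≤ 1)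
    (hsmall : 1136016 * (L : ℝ) ^ 4 * R ≤ (5408 * (1 + (Fintype.card (Fol L) : ℝ)) * (L : ℝ) ^ 6)⁻¹ / (8 * ((finrank ℝ (GnoFibreB L) : ℝ) + 8))) (hDR : 2 * R * R ≤ 1)
    (hb1 : 1 ≤ b)
    (hrate : (16 * (1136016 * (L : ℝ) ^ 4) * ((finrank ℝ (GnoFibreB L) : ℝ) + 8) / (5408 * (1 + (Fintype.card (Fol L) : ℝ)) * (L : ℝ) ^ 6)⁻¹ +
          256 * (1136016 * (L : ℝ) ^ 4) * ((finrank ℝ (GnoFibreB L) : ℝ) + 8) ^ 2 / ((5408 * (1 + (Fintype.card (Fol L) : ℝ)) * (L : ℝ) ^ 6)⁻¹) ^ 2 + 2 * R +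
          8 * (2 * R) * ((finrank ℝ (GnoFibreB L) : ℝ) + 8) / (5408 * (1 + (Fintype.card (Fol L) : ℝ)) * (L : ℝ) ^ 6)⁻¹) / Real.sqrt b +
        16 * ((finrank ℝ (GnoFibreB L) : ℝ) + 8) / ((5408 * (1 + (Fintype.card (Fol L) : ℝ)) * (L : ℝ) ^ 6)⁻¹ * R ^ 2) / b + b ^ (-(1 / 4 : ℝ)) ≤
      1 / (20000 * (L : ℝ) ^ 4))
    (habs : ∀ t : ℝ, b ≤ t → t ≤ 2 * b →
      Real.exp (-(t * (R ^ 2 / (10816 * (1 + (Fintype.card (Fol L) : ℝ)) * (L : ℝ) ^ 6)))) * (Real.pi * Real.exp (|Real.log (coneConst ^ 3 / 64)| + 18 * (L : ℝ) ^ 4)) ≤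
        t ^ (-(1 / 4 : ℝ)) * ((2 * Real.pi / t) ^ ((finrank ℝ (GnoFibreB L) : ℝ) / 2) * ((1 / 4) / Real.sqrt ((39984 * (L : ℝ) ^ 4) ^ finrank ℝ (GnoFibreB L))))) :
    stiffKappa L (1 / 8) *
        ∫ p, Real.exp (-(b * trGnoDeficit uJ z₁ (sectorChar z₁) (hubAt p.1 1) ε p.2))
          ∂((volume : Measure (ℝ × GnoCoord L)).withDensity fun p => ENNReal.ofReal (((1 + p.1 ^ 2)⁻¹) ^ 2 * gnoDensity p.2)) ≤
      b * ∫ p, trGnoDeficit uJ z₁ (sectorChar z₁) (hubAt p.1 1) ε p.2 * Real.exp (-(b * trGnoDeficit uJ z₁ (sectorChar z₁) (hubAt p.1 1) ε p.2))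
          ∂((volume : Measure (ℝ × GnoCoord L)).withDensity fun p => ENNReal.ofReal (((1 + p.1 ^ 2)⁻¹) ^ 2 * gnoDensity p.2)) := by
  have hL1 : (1 : ℝ) ≤ L := by exact_mod_cast NeZero.one_le
  have hL0 : (0 : ℝ) < L := by linarith
  have hb0 : 0 < b := by linarith
  -- the package
  obtain ⟨A, -, -, -, -, -, hdet, hint, hlaw⟩ := tr_mainTerm_package (L := L) ε hz hF
  -- names
  set μB : Measure (ℝ × GnoCoord L) := (volume : Measure (ℝ × GnoCoord L)).withDensity fun p => ENNReal.ofReal (((1 + p.1 ^ 2)⁻¹) ^ 2 * gnoDensity p.2) with hμB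
  haveI : IsFiniteMeasure μB := isFiniteMeasure_muB
  set F : ℝ × GnoCoord L → ℝ := fun p => trGnoDeficit uJ z₁ (sectorChar z₁) (hubAt p.1 1) ε p.2 with hFdef
  have hFm : Measurable F := (contDiff_trDeficit (n := 0) ε).continuous.measurable
  obtain ⟨B, -, hB⟩ := exists_abs_trGnoDeficit_le (L := L) uJ z₁ (sectorChar z₁)
  have hFbd : ∀ p, |F p| ≤ B := fun p => hB (hubAt p.1 1) ε p.2
  set lam : ℝ := (5408 * (1 + (Fintype.card (Fol L) : ℝ)) * (L : ℝ) ^ 6)⁻¹ with hlam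
  have hlam0 : 0 < lam := by positivity
  set m : ℝ := (finrank ℝ (GnoFibreB L) : ℝ) with hm
  have hm0 : 0 ≤ m := Nat.cast_nonneg _
  set e : ℝ := m / 2 with hedef
  have he0 : 0 ≤ e := by positivity
  set w₀ : ℝ × ℝ → ℝ := fun u => (1 + u.1 ^ 2)⁻¹ * (1 + u.2 ^ 2)⁻¹ with hw₀
  set M : ℝ := ∫ u in (univ : Set (ℝ × ℝ)), w₀ u / Real.sqrt (LinearMap.det (A u)) with hMdef
  set M₀ : ℝ := (1 / 4) / Real.sqrt ((39984 * (L : ℝ) ^ 4) ^ finrank ℝ (GnoFibreB L)) with hM₀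
  set U₀ : ℝ := Real.pi * Real.exp (|Real.log (coneConst ^ 3 / 64)| + 18 * (L : ℝ) ^ 4) with hU₀
  set K₃ : ℝ := 16 * (1136016 * (L : ℝ) ^ 4) * (m + 8) / lam + 256 * (1136016 * (L : ℝ) ^ 4) * (m + 8) ^ 2 / lam ^ 2 + 2 * R +
    8 * (2 * R) * (m + 8) / lam with hK₃
  set K₄ : ℝ := 16 * (m + 8) / (lam * R ^ 2) with hK₄
  have hK₃0 : 0 ≤ K₃ := by positivity
  have hK₄0 : 0 ≤ K₄ := by positivity
  -- (i) the main-term floor `M₀ ≤ M` (unit square: `w₀ ≥ 1∕4`, `det ≤ (39984L⁴)^m`)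
  have hC0 : 0 < Real.sqrt ((39984 * (L : ℝ) ^ 4) ^ finrank ℝ (GnoFibreB L)) := Real.sqrt_pos.2 (by positivity)
  have hM₀pos : 0 < M₀ := by positivity
  have hinteg_nn : ∀ u : ℝ × ℝ, 0 ≤ w₀ u / Real.sqrt (LinearMap.det (A u)) := fun u => div_nonneg (by positivity) (Real.sqrt_nonneg _)
  have hfloorQ : ∀ u ∈ Icc (0 : ℝ) 1 ×ˢ Icc (0 : ℝ) 1, (1 / 4) / Real.sqrt ((39984 * (L : ℝ) ^ 4) ^ finrank ℝ (GnoFibreB L)) ≤ w₀ u / Real.sqrt (LinearMap.det (A u)) := by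
    intro u hu
    obtain ⟨⟨h1, h2⟩, ⟨h3, h4⟩⟩ := mem_prod.1 hu
    have ha : (1 : ℝ) / 2 ≤ (1 + u.1 ^ 2)⁻¹ := by
      rw [div_le_iff₀ (by norm_num : (0 : ℝ) < 2), inv_mul_eq_div, le_div_iff₀ (by positivity)]; nlinarith
    have hb' : (1 : ℝ) / 2 ≤ (1 + u.2 ^ 2)⁻¹ := by
      rw [div_le_iff₀ (by norm_num : (0 : ℝ) < 2), inv_mul_eq_div, le_div_iff₀ (by positivity)]; nlinarith
    have hw : 1 / 4 ≤ w₀ u := by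
      have e4 : (1 : ℝ) / 4 = 1 / 2 * (1 / 2) := by norm_num
      rw [e4]
      exact mul_le_mul ha hb' (by norm_num) (le_trans (by norm_num) ha)
    obtain ⟨hd1, hd2⟩ := hdet u
    have hdpos : 0 < LinearMap.det (A u) := lt_of_lt_of_le (by positivity) hd1
    have hs : Real.sqrt (LinearMap.det (A u)) ≤ Real.sqrt ((39984 * (L : ℝ) ^ 4) ^ finrank ℝ (GnoFibreB L)) := Real.sqrt_le_sqrt hd2
    have hs0 : 0 < Real.sqrt (LinearMap.det (A u)) := Real.sqrt_pos.2 hdpos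
    calc (1 / 4) / Real.sqrt ((39984 * (L : ℝ) ^ 4) ^ finrank ℝ (GnoFibreB L)) ≤ (1 / 4) / Real.sqrt (LinearMap.det (A u)) :=
          div_le_div_of_nonneg_left (by norm_num) hs0 hs
      _ ≤ w₀ u / Real.sqrt (LinearMap.det (A u)) := div_le_div_of_nonneg_right hw hs0.le
  have hvolQ : (volume : Measure (ℝ × ℝ)).real (Icc (0 : ℝ) 1 ×ˢ Icc (0 : ℝ) 1) = 1 := by
    rw [measureReal_def, Measure.volume_eq_prod, Measure.prod_prod, Real.volume_Icc, ← ENNReal.ofReal_mul (by norm_num), ENNReal.toReal_ofReal (by norm_num)]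
    norm_num
  have hMfloor : M₀ ≤ M := by
    have hQm : MeasurableSet (Icc (0 : ℝ) 1 ×ˢ Icc (0 : ℝ) 1) := measurableSet_Icc.prod measurableSet_Icc
    have hQfin : (volume : Measure (ℝ × ℝ)) (Icc (0 : ℝ) 1 ×ˢ Icc (0 : ℝ) 1) ≠ ⊤ := by
      rw [Measure.volume_eq_prod, Measure.prod_prod, Real.volume_Icc]
      exact ENNReal.mul_ne_top ENNReal.ofReal_ne_top ENNReal.ofReal_ne_top
    have h1 := setIntegral_ge_of_const_le_real (μ := (volume : Measure (ℝ × ℝ))) hQm hQfin hfloorQ (hint.integrableOn)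
    have h2 : ∫ u in Icc (0 : ℝ) 1 ×ˢ Icc (0 : ℝ) 1, w₀ u / Real.sqrt (LinearMap.det (A u)) ≤ M := by
      rw [hMdef, Measure.restrict_univ]
      exact setIntegral_le_integral hint (Filter.Eventually.of_forall hinteg_nn)
    rw [hvolQ, mul_one] at h1
    exact h1.trans h2
  have hMpos : 0 < M := lt_of_lt_of_le hM₀pos hMfloor
  -- (ii) total mass
  have hμtot : μB.real univ ≤ U₀ := muB_real_univ_le (L := L)
  have hμtot0 : 0 ≤ μB.real univ := measureReal_nonneg
  -- (iii) the law at a time `t ∈ [b, 2b]`, in relative form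
  have hrel : ∀ t : ℝ, b ≤ t → t ≤ 2 * b →
      0 < ∫ p, Real.exp (-(t * F p)) ∂μB ∧
      -e * Real.log t + (e * Real.log (2 * Real.pi) + Real.log M) - 2 * (K₃ / Real.sqrt t + K₄ / t + t ^ (-(1 / 4 : ℝ))) ≤
          Real.log (∫ p, Real.exp (-(t * F p)) ∂μB) ∧
        Real.log (∫ p, Real.exp (-(t * F p)) ∂μB) ≤
          -e * Real.log t + (e * Real.log (2 * Real.pi) + Real.log M) + (K₃ / Real.sqrt t + K₄ / t + t ^ (-(1 / 4 : ℝ))) := by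
    intro t hbt ht2
    have ht0 : 0 < t := by linarith
    have ht1 : 1 ≤ t := hb1.trans hbt
    have hZ := hlaw hR hR1 ht0 hsmall hDR
    -- the rate
    have hr0 : 0 ≤ K₃ / Real.sqrt t + K₄ / t := by positivity
    have hx0 : 0 ≤ t ^ (-(1 / 4 : ℝ)) := Real.rpow_nonneg ht0.le _
    have hrate_t : K₃ / Real.sqrt t + K₄ / t + t ^ (-(1 / 4 : ℝ)) ≤ 1 / (20000 * (L : ℝ) ^ 4) := (bRate_antitone hK₃0 hK₄0 hb1 hbt).trans hrate
    have hhalf : K₃ / Real.sqrt t + K₄ / t + t ^ (-(1 / 4 : ℝ)) ≤ 1 / 2 := hrate_t.trans (by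
      rw [div_le_div_iff₀ (by positivity) (by norm_num)]; nlinarith [one_le_pow₀ (n := 4) hL1])
    -- absorb the tail
    have hP0 : 0 < (2 * Real.pi / t) ^ e := Real.rpow_pos_of_pos (by positivity) _
    have hX : Real.exp (-(t * (R ^ 2 / (10816 * (1 + (Fintype.card (Fol L) : ℝ)) * (L : ℝ) ^ 6)))) * μB.real univ ≤ t ^ (-(1 / 4 : ℝ)) * ((2 * Real.pi / t) ^ e * M) := by
      have h1 := habs t hbt ht2
      calc Real.exp (-(t * (R ^ 2 / (10816 * (1 + (Fintype.card (Fol L) : ℝ)) * (L : ℝ) ^ 6)))) * μB.real univ ≤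
            Real.exp (-(t * (R ^ 2 / (10816 * (1 + (Fintype.card (Fol L) : ℝ)) * (L : ℝ) ^ 6)))) * U₀ := mul_le_mul_of_nonneg_left hμtot (Real.exp_pos _).le
        _ ≤ t ^ (-(1 / 4 : ℝ)) * ((2 * Real.pi / t) ^ e * M₀) := h1
        _ ≤ t ^ (-(1 / 4 : ℝ)) * ((2 * Real.pi / t) ^ e * M) := mul_le_mul_of_nonneg_left (mul_le_mul_of_nonneg_left hMfloor hP0.le) hx0
    -- the law in the form of `twoSided_logLaw_of_relative`
    have hZ' : |(∫ p, Real.exp (-(t * F p)) ∂μB) - (2 * Real.pi / t) ^ e * M| ≤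
        (K₃ / Real.sqrt t + K₄ / t) * ((2 * Real.pi / t) ^ e * M) + Real.exp (-(t * (R ^ 2 / (10816 * (1 + (Fintype.card (Fol L) : ℝ)) * (L : ℝ) ^ 6)))) * μB.real univ := by
      have e1 : (K₃ / Real.sqrt t + K₄ / t) * ((2 * Real.pi / t) ^ e * M) =
          (K₃ / Real.sqrt t + 16 * (m + 8) / (lam * R ^ 2) / t) * ((2 * Real.pi / t) ^ e * M) := by rw [hK₄]
      rw [e1]
      exact hZ
    exact twoSided_logLaw_of_relative ht0 hMpos hZ' hX hr0 hx0 hhalf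
  -- (iv) the two-sided log law at `b` and `(1+h)b`, then stiffness
  have hh0 : (0 : ℝ) < 1 / (40 * (L : ℝ) ^ 4) := by positivity
  have hhb : b ≤ (1 + 1 / (40 * (L : ℝ) ^ 4)) * b := by nlinarith
  have hhb2 : (1 + 1 / (40 * (L : ℝ) ^ 4)) * b ≤ 2 * b := by
    have : 1 / (40 * (L : ℝ) ^ 4) ≤ 1 := by rw [div_le_one (by positivity)]; nlinarith [one_le_pow₀ (n := 4) hL1]
    nlinarith
  obtain ⟨hZpos, hlow, -⟩ := hrel b le_rfl (by linarith)
  obtain ⟨-, -, hup⟩ := hrel ((1 + 1 / (40 * (L : ℝ) ^ 4)) * b) hhb hhb2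
  haveI : NeZero μB := ⟨fun h0 => by
    have : ∫ p, Real.exp (-(b * F p)) ∂μB = 0 := by rw [h0, integral_zero_measure]
    rw [this] at hZpos; exact lt_irrefl _ hZpos⟩
  -- integrand forms `-(t*F)` ↔ `-t * F`
  have eZ : ∀ t : ℝ, ∫ p, Real.exp (-t * F p) ∂μB = ∫ p, Real.exp (-(t * F p)) ∂μB := fun t => by simp only [neg_mul]
  have eE : ∫ p, F p * Real.exp (-b * F p) ∂μB = ∫ p, F p * Real.exp (-(b * F p)) ∂μB := by simp only [neg_mul]
  have hst := stiffness_of_twoSided_logLaplace_finite μB hFm hFbd hb0 hh0 he0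
    (C := e * Real.log (2 * Real.pi) + Real.log M)
    (E₁ := 2 * (K₃ / Real.sqrt b + K₄ / b + b ^ (-(1 / 4 : ℝ))))
    (E₂ := K₃ / Real.sqrt ((1 + 1 / (40 * (L : ℝ) ^ 4)) * b) + K₄ / ((1 + 1 / (40 * (L : ℝ) ^ 4)) * b) +
      ((1 + 1 / (40 * (L : ℝ) ^ 4)) * b) ^ (-(1 / 4 : ℝ)))
    (by rw [eZ]; exact hlow) (by rw [eZ]; exact hup)
  rw [eZ, eE] at hst
  -- (v) the budget
  have hρb' : K₃ / Real.sqrt ((1 + 1 / (40 * (L : ℝ) ^ 4)) * b) + K₄ / ((1 + 1 / (40 * (L : ℝ) ^ 4)) * b) +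
      ((1 + 1 / (40 * (L : ℝ) ^ 4)) * b) ^ (-(1 / 4 : ℝ)) ≤ 1 / (20000 * (L : ℝ) ^ 4) := (bRate_antitone hK₃0 hK₄0 hb1 hhb).trans hrate
  have hEle : 2 * (K₃ / Real.sqrt b + K₄ / b + b ^ (-(1 / 4 : ℝ))) +
      (K₃ / Real.sqrt ((1 + 1 / (40 * (L : ℝ) ^ 4)) * b) + K₄ / ((1 + 1 / (40 * (L : ℝ) ^ 4)) * b) +
        ((1 + 1 / (40 * (L : ℝ) ^ 4)) * b) ^ (-(1 / 4 : ℝ))) ≤ 3 / (20000 * (L : ℝ) ^ 4) := by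
    have e3 : (3 : ℝ) / (20000 * (L : ℝ) ^ 4) = 3 * (1 / (20000 * (L : ℝ) ^ 4)) := by ring
    rw [e3]; linarith
  have hbudget := stiff_budget (L := L) hEle
  -- `α ≤ e`
  have hαe : alpha L / (1 + 1 / (40 * (L : ℝ) ^ 4)) ≤ e / (1 + 1 / (40 * (L : ℝ) ^ 4)) :=
    div_le_div_of_nonneg_right (alpha_le_finrank_gnoFibreB_div_two (L := L)) (by positivity)
  have hZ0 : 0 ≤ ∫ p, Real.exp (-(b * F p)) ∂μB := hZpos.le
  have hκ : stiffKappa L (1 / 8) ≤ e / (1 + 1 / (40 * (L : ℝ) ^ 4)) -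
      (2 * (K₃ / Real.sqrt b + K₄ / b + b ^ (-(1 / 4 : ℝ))) +
        (K₃ / Real.sqrt ((1 + 1 / (40 * (L : ℝ) ^ 4)) * b) + K₄ / ((1 + 1 / (40 * (L : ℝ) ^ 4)) * b) +
          ((1 + 1 / (40 * (L : ℝ) ^ 4)) * b) ^ (-(1 / 4 : ℝ)))) / (1 / (40 * (L : ℝ) ^ 4)) := by linarith
  exact le_trans (mul_le_mul_of_nonneg_right hκ hZ0) hst

end Summit.QuantumFields.YangMills.Theorems.SwapVirialDeficit.BlowUpRing

end
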